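import Summits.Schanuel.Schanuel.Theorems.DiophantineDichotomyApproximationPropertyOrbitDichotomy
import Literature.NumberTheory.Transcendental.PhilipponCriterionCut
import Literature.NumberTheory.Transcendental.NesterenkoEliminationProp411Holds
import Literature.NumberTheory.Transcendental.NesterenkoEliminationProp47Holds
import HarnessLib

/-!
# Stub plan `CycleAPIAt3`, P2 `OrbitFloor` — counting lemmas (crux `ApproximationProperty`, stmt-Schanuel-6117)

Crux `stmt-Schanuel-6117` (`Summit.Schanuel.Schanuel.Theses.DiophantineDichotomy.ApproximationProperty`),
line `orbit-interpolation-determinant`, registered stub `stub_orbitFloor : OrbitFloor` (stub plan P2,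
`Cruxes/ApproximationProperty/STUB-PLAN-CycleAPIAt3.md`). This file carries the COUNTING half of the
orbit floor (all PROVED, no definitions of statements, no named facts):

* `OrbitFloor.isHomogeneous_homog`, `OrbitFloor.aeval_homog*` — the two-variable homogenisation
  `x_i^d p(x_j/x_i) = ∑ₖ aₖ x_j^k x_i^{d−k}` of a univariate rational polynomial (written out as a
  sum, no new definition), with its evaluation formulas;
* `OrbitFloor.card_le_ideg_of_rankOne` — a homogeneous unmixed ideal `J ⊂ ℚ[x₀, …, x_m]` of rank `1`
  has at most `deg J` pairwise non-proportional projective zeros (reduced primary decomposition,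
  LNM 1752 Ch. 3 Prop. 4.7 1), and the landed dictionary `stub_zeroDimDictionary` for each component);
* `OrbitFloor.exists_chart_finrank_le` (registered sub-goal `orbitFloor_fibreBound`, uncurried at the
  end of the file) — the FIBRE BOUND of the chart:
  if a prime orbit `V(𝔭) = {σ(b̄)}` (rank `1`) lies on a `ℚ`-curve `V(𝔮)` (`𝔮 ≤ 𝔭` prime of rank
  `2`) and `b_{i} ≠ 0`, then for some coordinate `j` the ratio `y = b_j/b_i` has
  `[K : ℚ(y)] ≤ deg 𝔮`: either the homogenised minimal polynomial `M_j` of `y` misses `𝔮`, and then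
  the `deg 𝔭 = [K:ℚ]` orbit points lie on the cut `V(𝔮) ∩ V(M_j)` of degree `≤ deg 𝔮 · deg M_j`
  (Prop. 4.11), or all three `M_j ∈ 𝔮`, and then `V(𝔮)` could not meet the hyperplane `x_i = 0`,
  which every curve does (Prop. 4.11 again).

Sources: NesterenkoPhilippon2001 (LNM 1752) Ch. 3 §4 (Prop. 4.7, 4.11); folklore field theory.
-/

noncomputable section

-- `Summit.Schanuel.Schanuel.…` is the mandated summit/sub-problem namespace (single-conjunct summit), hence:
set_option linter.dupNamespace false

namespace Summit.Schanuel.Schanuel.Cruxes.ApproximationProperty.OrbitInterpolationDeterminant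

open Literature.NumberTheory.Transcendental Literature.NumberTheory.Transcendental.Nesterenko
open Literature.NumberTheory.Transcendental.PhilipponMain MvPolynomial
open scoped BigOperators Polynomial IntermediateField

namespace OrbitFloor

variable {m : ℕ}

/-! ## Homogenised univariate polynomials -/

/-- The two-variable homogenisation `x_i^d · p(x_j / x_i) = ∑ₖ aₖ x_j^k x_i^{d-k}` (`d = deg p`) of a
univariate rational polynomial `p` is a form of degree `deg p`. [folklore] -/
theorem isHomogeneous_homog (p : ℚ[X]) (i j : Fin (m + 1)) :
    (∑ k ∈ Finset.range (p.natDegree + 1),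
      C (p.coeff k) * ((X j : Rx m) ^ k * (X i : Rx m) ^ (p.natDegree - k))).IsHomogeneous
      p.natDegree := by
  refine IsHomogeneous.sum _ _ _ fun k hk => ?_
  have hk' : k ≤ p.natDegree := Nat.lt_succ_iff.mp (Finset.mem_range.mp hk)
  have h : ((X j : Rx m) ^ k * (X i : Rx m) ^ (p.natDegree - k)).IsHomogeneous
      (k + (p.natDegree - k)) :=
    (isHomogeneous_X_pow j k).mul (isHomogeneous_X_pow i _)
  rw [Nat.add_sub_cancel' hk'] at h
  simpa using (isHomogeneous_C (Fin (m + 1)) (p.coeff k)).mul h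

/-- Evaluation of the homogenisation. [folklore] -/
theorem aeval_homog {A : Type*} [CommRing A] [Algebra ℚ A] (p : ℚ[X]) (i j : Fin (m + 1))
    (β : Fin (m + 1) → A) :
    aeval β (∑ k ∈ Finset.range (p.natDegree + 1),
      C (p.coeff k) * ((X j : Rx m) ^ k * (X i : Rx m) ^ (p.natDegree - k))) =
      ∑ k ∈ Finset.range (p.natDegree + 1),
        algebraMap ℚ A (p.coeff k) * (β j ^ k * β i ^ (p.natDegree - k)) := by
  simp only [map_sum, map_mul, map_pow, aeval_X, aeval_C]

/-- In the chart `β_i ≠ 0` the homogenisation evaluates to `β_i^d · p(β_j/β_i)`. [folklore] -/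
theorem aeval_homog_of_ne_zero {A : Type*} [Field A] [Algebra ℚ A] (p : ℚ[X]) (i j : Fin (m + 1))
    (β : Fin (m + 1) → A) (hi : β i ≠ 0) :
    aeval β (∑ k ∈ Finset.range (p.natDegree + 1),
      C (p.coeff k) * ((X j : Rx m) ^ k * (X i : Rx m) ^ (p.natDegree - k))) =
      β i ^ p.natDegree * Polynomial.aeval (β j / β i) p := by
  rw [aeval_homog, Polynomial.aeval_eq_sum_range, Finset.mul_sum]
  refine Finset.sum_congr rfl fun k hk => ?_
  have hk' : k ≤ p.natDegree := Nat.lt_succ_iff.mp (Finset.mem_range.mp hk)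
  rw [Algebra.smul_def, div_pow, ← pow_sub_mul_pow (β i) hk']
  field_simp

/-- Off the chart (`β_i = 0`) the homogenisation evaluates to `lead(p) · β_j^d`. [folklore] -/
theorem aeval_homog_of_eq_zero {A : Type*} [CommRing A] [Algebra ℚ A] (p : ℚ[X]) (i j : Fin (m + 1))
    (β : Fin (m + 1) → A) (hi : β i = 0) :
    aeval β (∑ k ∈ Finset.range (p.natDegree + 1),
      C (p.coeff k) * ((X j : Rx m) ^ k * (X i : Rx m) ^ (p.natDegree - k))) =
      algebraMap ℚ A p.leadingCoeff * β j ^ p.natDegree := by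
  rw [aeval_homog, Finset.sum_eq_single p.natDegree]
  · rw [Nat.sub_self, pow_zero, mul_one, Polynomial.leadingCoeff]
  · intro k hk hne
    have hk' : k < p.natDegree :=
      lt_of_le_of_ne (Nat.lt_succ_iff.mp (Finset.mem_range.mp hk)) hne
    rw [hi, zero_pow (Nat.sub_ne_zero_of_lt hk'), mul_zero, mul_zero]
  · intro h
    exact absurd (Finset.self_mem_range_succ _) h

/-- The homogenised MINIMAL polynomial of `y = b_j/b_i` vanishes at `b̄`. [folklore] -/
theorem aeval_homog_minpoly_eq_zero {K : Type*} [Field K] [Algebra ℚ K] (b : Fin (m + 1) → K)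
    {i : Fin (m + 1)} (hi : b i ≠ 0) (j : Fin (m + 1)) :
    aeval b (∑ k ∈ Finset.range ((minpoly ℚ (b j / b i)).natDegree + 1),
      C ((minpoly ℚ (b j / b i)).coeff k) *
        ((X j : Rx m) ^ k * (X i : Rx m) ^ ((minpoly ℚ (b j / b i)).natDegree - k))) = 0 := by
  rw [aeval_homog_of_ne_zero _ _ _ _ hi, minpoly.aeval, mul_zero]

/-- … hence at every conjugate `σ(b̄)`. [folklore] -/
theorem aeval_conj_homog_minpoly_eq_zero {K : Type*} [Field K] [CharZero K] (σ : K →+* ℂ)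
    (b : Fin (m + 1) → K) {i : Fin (m + 1)} (hi : b i ≠ 0) (j : Fin (m + 1)) :
    aeval (fun k => σ (b k)) (∑ k ∈ Finset.range ((minpoly ℚ (b j / b i)).natDegree + 1),
      C ((minpoly ℚ (b j / b i)).coeff k) *
        ((X j : Rx m) ^ k * (X i : Rx m) ^ ((minpoly ℚ (b j / b i)).natDegree - k))) = 0 := by
  set G : Rx m := ∑ k ∈ Finset.range ((minpoly ℚ (b j / b i)).natDegree + 1),
      C ((minpoly ℚ (b j / b i)).coeff k) *
        ((X j : Rx m) ^ k * (X i : Rx m) ^ ((minpoly ℚ (b j / b i)).natDegree - k)) with hG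
  have hq : σ.comp (algebraMap ℚ K) = algebraMap ℚ ℂ := Subsingleton.elim _ _
  have h : aeval (fun k => σ (b k)) G = σ (aeval b G) := by
    rw [map_aeval, hq, aeval_def, coe_eval₂Hom]
  rw [h, hG, aeval_homog_minpoly_eq_zero b hi j, map_zero]

/-! ## Points of an unmixed ideal of rank `1` -/

/-- **A homogeneous unmixed ideal of rank `1` has at most `deg J` pairwise non-proportional
projective zeros**: `V(J) = ⋃ V(√Q)` over a reduced primary decomposition, each `V(√Q)` consists of
the `deg √Q = [K_Q : ℚ]` conjugates of one point (dictionary (A), (B′), (B)), and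
`∑ deg √Q ≤ ∑ k_Q deg √Q = deg J` (Prop. 4.7 1)).
[cite: NesterenkoPhilippon2001, Ch. 3 Prop. 4.7 (p. 39)] -/
theorem card_le_ideg_of_rankOne (hm : 1 ≤ m) {J : Ideal (Rx m)}
    (hJhom : letI := MvPolynomial.gradedAlgebra (σ := Fin (m + 1)) (R := ℚ);
      J.IsHomogeneous (homogeneousSubmodule (Fin (m + 1)) ℚ)) (hJunm : IsUnmixedOfRank J 1)
    (S : Finset (Fin (m + 1) → ℂ)) (hS : ∀ s ∈ S, s ∈ projZeros J)
    (hprop : ∀ s ∈ S, ∀ s' ∈ S, ∀ l : ℂ, s = l • s' → s = s') : S.card ≤ ideg J 1 := by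
  classical
  obtain ⟨t, ht⟩ : ∃ t : Finset (Ideal (Rx m)), Submodule.IsMinimalPrimaryDecomposition J t :=
    Submodule.IsLasker.exists_isMinimalPrimaryDecomposition (Submodule.isLasker _ _) J
  have h47 := NesterenkoPhilippon2001_ch3_prop_4_7_holds
  have hω : (fun _ => (1 : ℂ) : Fin (m + 1) → ℂ) ≠ 0 :=
    Function.ne_iff.mpr ⟨0, one_ne_zero⟩
  obtain ⟨hdegsum, -, -⟩ := h47 m 1 J le_rfl hm hJhom hJunm t ht _ hω
  -- `S ⊆ ⋃ V(√Q)`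
  have hcover : ∀ s ∈ S, ∃ Q ∈ t, s ∈ projZeros Q.radical := by
    intro s hs
    have h := hS s hs
    rw [projZeros_eq_biUnion_radical ht.inf_eq, Set.mem_iUnion₂] at h
    obtain ⟨Q, hQ, h⟩ := h
    exact ⟨Q, hQ, h⟩
  have h1 : S.card ≤ ∑ Q ∈ t, (S.filter fun s => s ∈ projZeros Q.radical).card := by
    have hsub : S ⊆ t.biUnion fun Q => S.filter fun s => s ∈ projZeros Q.radical := by
      intro s hs
      obtain ⟨Q, hQ, hsQ⟩ := hcover s hs
      exact Finset.mem_biUnion.mpr ⟨Q, hQ, Finset.mem_filter.mpr ⟨hs, hsQ⟩⟩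
    exact (Finset.card_le_card hsub).trans Finset.card_biUnion_le
  -- each component carries at most `deg √Q` points of `S`
  have h2 : ∀ Q ∈ t, (S.filter fun s => s ∈ projZeros Q.radical).card ≤
      primaryExponent Q * ideg Q.radical 1 := by
    intro Q hQ
    obtain ⟨hqprime, hqhom, hqunm, -, hexp⟩ :=
      Literature.Barriers.Schanuel.radical_component_facts hJhom hJunm ht hQ
    obtain ⟨c, -, hdict⟩ := stub_zeroDimDictionary m hm
    obtain ⟨K, _, _, b, hb0, hzeros, hinj, hdeg, -⟩ := hdict Q.radical hqprime hqhom hqunm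
    set SQ := S.filter fun s => s ∈ projZeros Q.radical with hSQ
    have hch : ∀ s ∈ SQ, ∃ σ : K →+* ℂ, ∃ l : ℂ, s = fun k => l * σ (b k) := by
      intro s hs
      obtain ⟨-, σ, l, h⟩ := (hzeros s).mp (Finset.mem_filter.mp hs).2
      exact ⟨σ, l, h⟩
    choose! σ l hσ using hch
    have hinjS : Set.InjOn σ ↑SQ := by
      intro s hs s' hs' heq
      have hsS : s ∈ S := (Finset.mem_filter.mp hs).1
      have hs'S : s' ∈ S := (Finset.mem_filter.mp hs').1
      have hs'0 : s' ≠ 0 := ((Finset.mem_filter.mp hs').2).1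
      have hl' : l s' ≠ 0 := by
        intro h0
        apply hs'0
        rw [hσ s' hs']
        funext k
        rw [h0, zero_mul, Pi.zero_apply]
      refine hprop s hsS s' hs'S (l s / l s') ?_
      funext k
      have h1 := congrFun (hσ s hs) k
      have h2 := congrFun (hσ s' hs') k
      rw [Pi.smul_apply, smul_eq_mul, h1, h2, heq]
      field_simp
    calc SQ.card ≤ (Finset.univ : Finset (K →+* ℂ)).card :=
          Finset.card_le_card_of_injOn σ (fun _ _ => Finset.mem_univ _) hinjS
      _ = Module.finrank ℚ K := by rw [Finset.card_univ, NumberField.Embeddings.card K ℂ]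
      _ = ideg Q.radical 1 := hdeg
      _ ≤ primaryExponent Q * ideg Q.radical 1 := Nat.le_mul_of_pos_left _ hexp
  calc S.card ≤ ∑ Q ∈ t, (S.filter fun s => s ∈ projZeros Q.radical).card := h1
    _ ≤ ∑ Q ∈ t, primaryExponent Q * ideg Q.radical 1 := Finset.sum_le_sum h2
    _ = ideg J 1 := hdegsum

/-! ## The fibre bound of the chart -/

/-- **The fibre bound** (registered below as `orbitFloor_fibreBound`). Let `𝔭 ⊂ ℚ[x₀, …, x_m]` (`m ≥ 2`)
be a homogeneous prime of rank `1` whose zeros are the conjugates `σ(b̄)` of a point `b̄ ∈ K^{m+1}`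
over a number field `K` with `[K : ℚ] = deg 𝔭` (dictionary (A), (B′), (B)), lying on a `ℚ`-curve
`V(𝔮)`, `𝔮 ≤ 𝔭` a homogeneous prime of rank `2`, and let `b_i ≠ 0`. Then some coordinate ratio
`y = b_j / b_i` has `[K : ℚ(y)] ≤ deg 𝔮`. (If the homogenised minimal polynomial `M_j` of `y` is not
in `𝔮`, the `deg 𝔭` orbit points lie on the rank-`1` cut of `V(𝔮)` by `M_j`, of degree
`≤ deg 𝔮 · deg M_j = deg 𝔮 · [ℚ(y):ℚ]` (Prop. 4.11, `card_le_ideg_of_rankOne`), and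
`[K:ℚ] = [K:ℚ(y)] [ℚ(y):ℚ]`; if all `M_j ∈ 𝔮`, a zero of `𝔮` on the hyperplane `x_i = 0`
(Prop. 4.11) would have all its coordinates zero.)
[cite: NesterenkoPhilippon2001, Ch. 3 Prop. 4.11 (pp. 40–41)] -/
theorem exists_chart_finrank_le (hm : 2 ≤ m) {𝔭 𝔮 : Ideal (Rx m)}
    (h𝔮 : 𝔮.IsPrime) (h𝔮hom : letI := MvPolynomial.gradedAlgebra (σ := Fin (m + 1)) (R := ℚ);
      𝔮.IsHomogeneous (homogeneousSubmodule (Fin (m + 1)) ℚ))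
    (h𝔮unm : IsUnmixedOfRank 𝔮 2) (hle : 𝔮 ≤ 𝔭)
    {K : Type*} [Field K] [NumberField K] (b : Fin (m + 1) → K)
    (hzeros : ∀ β : Fin (m + 1) → ℂ,
      β ∈ projZeros 𝔭 ↔ β ≠ 0 ∧ ∃ (σ : K →+* ℂ) (l : ℂ), β = fun k => l * σ (b k))
    (hinj : ∀ (σ τ : K →+* ℂ) (l : ℂ), ((fun k => σ (b k)) = fun k => l * τ (b k)) → σ = τ)
    (hdeg : Module.finrank ℚ K = ideg 𝔭 1) {i : Fin (m + 1)} (hi : b i ≠ 0) :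
    ∃ j : Fin (m + 1), Module.finrank ℚ⟮b j / b i⟯ K ≤ ideg 𝔮 2 := by
  classical
  have h411 := NesterenkoPhilippon2001_ch3_prop_4_11_holds
  -- the orbit as a finite set of vectors
  set orb : Finset (Fin (m + 1) → ℂ) :=
    Finset.univ.image fun σ : K →+* ℂ => fun k => σ (b k) with horb
  have horb_inj : Function.Injective fun σ : K →+* ℂ => fun k => σ (b k) := by
    intro σ τ h
    refine hinj σ τ 1 ?_
    have h' : (fun k => σ (b k)) = fun k => τ (b k) := h
    rw [h']
    funext k
    rw [one_mul]
  have hcard : orb.card = ideg 𝔭 1 := by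
    rw [horb, Finset.card_image_of_injective _ horb_inj, Finset.card_univ,
      NumberField.Embeddings.card K ℂ, hdeg]
  have horb𝔭 : ∀ s ∈ orb, s ∈ projZeros 𝔭 := by
    intro s hs
    obtain ⟨σ, -, rfl⟩ := Finset.mem_image.mp hs
    refine (hzeros _).mpr ⟨?_, σ, 1, funext fun k => by rw [one_mul]⟩
    intro h
    have h' := congrFun h i
    exact hi ((map_eq_zero σ).mp h')
  have hprop : ∀ s ∈ orb, ∀ s' ∈ orb, ∀ l : ℂ, s = l • s' → s = s' := by
    intro s hs s' hs' l h
    obtain ⟨σ, -, rfl⟩ := Finset.mem_image.mp hs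
    obtain ⟨τ, -, rfl⟩ := Finset.mem_image.mp hs'
    have hστ : σ = τ := hinj σ τ l (by rw [h]; rfl)
    rw [hστ]
  -- the homogenised minimal polynomials `M_j` of `b_j / b_i`
  have hMdeg : ∀ j, 1 ≤ (minpoly ℚ (b j / b i)).natDegree := fun j =>
    minpoly.natDegree_pos (Algebra.IsIntegral.isIntegral _)
  by_cases hcase : ∃ j, (∑ k ∈ Finset.range ((minpoly ℚ (b j / b i)).natDegree + 1),
      C ((minpoly ℚ (b j / b i)).coeff k) *
        ((X j : Rx m) ^ k * (X i : Rx m) ^ ((minpoly ℚ (b j / b i)).natDegree - k))) ∉ 𝔮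
  · obtain ⟨j, hj⟩ := hcase
    refine ⟨j, ?_⟩
    obtain ⟨J, hJhom, hJunm, hJV, hJdeg, -, -⟩ :=
      (h411 m 2 𝔮 _ _ (by norm_num) hm h𝔮 h𝔮hom h𝔮unm (isHomogeneous_homog _ i j) (hMdeg j)
        hj).1 le_rfl
    -- the orbit lies on the cut
    have horbJ : ∀ s ∈ orb, s ∈ projZeros J := by
      intro s hs
      rw [hJV, projZeros_sup, projZeros_span_singleton]
      have hs𝔭 := horb𝔭 s hs
      obtain ⟨σ, -, rfl⟩ := Finset.mem_image.mp hs
      exact ⟨projZeros_antitone hle hs𝔭, hs𝔭.1, aeval_conj_homog_minpoly_eq_zero σ b hi j⟩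
    have h1 : ideg 𝔭 1 ≤ ideg 𝔮 2 * (minpoly ℚ (b j / b i)).natDegree := by
      rw [← hcard]
      exact (card_le_ideg_of_rankOne (by omega) hJhom hJunm orb horbJ hprop).trans hJdeg
    have htower := Module.finrank_mul_finrank ℚ ℚ⟮b j / b i⟯ K
    have hFd : Module.finrank ℚ ℚ⟮b j / b i⟯ = (minpoly ℚ (b j / b i)).natDegree :=
      IntermediateField.adjoin.finrank (Algebra.IsIntegral.isIntegral _)
    rw [hFd, hdeg, mul_comm] at htower
    rw [← htower] at h1
    exact Nat.le_of_mul_le_mul_right h1 (hMdeg j)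
  · push Not at hcase
    exfalso
    -- `x_i ∉ 𝔮`: the orbit point has `b_i ≠ 0`
    have hXi : (X i : Rx m) ∉ 𝔮 := by
      intro hX
      have hpos : 0 < Fintype.card (K →+* ℂ) := by
        rw [NumberField.Embeddings.card K ℂ]; exact Module.finrank_pos
      obtain ⟨σ⟩ := Fintype.card_pos_iff.mp hpos
      have hz := horb𝔭 _ (Finset.mem_image.mpr ⟨σ, Finset.mem_univ _, rfl⟩)
      have h0 := (projZeros_antitone hle hz).2 _ hX
      rw [aeval_X] at h0
      exact hi ((map_eq_zero σ).mp h0)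
    obtain ⟨J, hJhom, hJunm, hJV, -, -, -⟩ :=
      (h411 m 2 𝔮 (X i) 1 (by norm_num) hm h𝔮 h𝔮hom h𝔮unm (isHomogeneous_X ℚ i) le_rfl hXi).1
        le_rfl
    -- the cut `V(𝔮) ∩ {x_i = 0}` has a point
    obtain ⟨t, ht⟩ : ∃ t : Finset (Ideal (Rx m)), Submodule.IsMinimalPrimaryDecomposition J t :=
      Submodule.IsLasker.exists_isMinimalPrimaryDecomposition (Submodule.isLasker _ _) J
    have htne : t.Nonempty := by
      by_contra h
      rw [Finset.not_nonempty_iff_eq_empty] at h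
      have hinf := ht.inf_eq
      rw [h, Finset.inf_empty] at hinf
      exact hJunm.1 hinf.symm
    obtain ⟨Q, hQ⟩ := htne
    obtain ⟨hqprime, hqhom, hqunm, -, -⟩ :=
      Literature.Barriers.Schanuel.radical_component_facts hJhom hJunm ht hQ
    obtain ⟨β, hβ⟩ := projZeros_nonempty' hqprime hqhom hqunm
    have hβJ : β ∈ projZeros J := projZeros_radical_subset_of_mem ht hQ hβ
    rw [hJV, projZeros_sup, projZeros_span_singleton] at hβJ
    obtain ⟨hβ𝔮, hβ0, hβi⟩ := hβJ
    rw [aeval_X] at hβi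
    apply hβ0
    funext k
    by_cases hk : k = i
    · rw [hk, hβi, Pi.zero_apply]
    · have h := hβ𝔮.2 _ (hcase k)
      rw [aeval_homog_of_eq_zero _ _ _ _ hβi,
        (minpoly.monic (Algebra.IsIntegral.isIntegral _)).leadingCoeff, map_one, one_mul] at h
      exact (pow_eq_zero_iff (Nat.one_le_iff_ne_zero.mp (hMdeg k))).mp h

end OrbitFloor

/-- **Registered sub-goal `orbitFloor_fibreBound` — the fibre bound of the chart** (uncurried form of
`OrbitFloor.exists_chart_finrank_le`): a prime orbit `V(𝔭) = {σ(b̄)}` over the number field `K`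
(`[K:ℚ] = deg 𝔭`) lying on a `ℚ`-curve `V(𝔮)` (`𝔮 ≤ 𝔭` prime of rank `2`) has, in any chart
`b_i ≠ 0`, a coordinate ratio `y = b_j/b_i` with `[K : ℚ(y)] ≤ deg 𝔮`.
[cite: NesterenkoPhilippon2001, Ch. 3 Prop. 4.11 (pp. 40–41)] -/
theorem orbitFloor_fibreBound : ∀ (m : ℕ), 2 ≤ m → ∀ (𝔭 𝔮 : Ideal (Rx m)), 𝔮.IsPrime → (letI := MvPolynomial.gradedAlgebra (σ := Fin (m + 1)) (R := ℚ); 𝔮.IsHomogeneous (homogeneousSubmodule (Fin (m + 1)) ℚ)) → IsUnmixedOfRank 𝔮 2 → 𝔮 ≤ 𝔭 → ∀ (K : Type) [Field K] [NumberField K] (b : Fin (m + 1) → K), (∀ β : Fin (m + 1) → ℂ, β ∈ projZeros 𝔭 ↔ β ≠ 0 ∧ ∃ (σ : K →+* ℂ) (l : ℂ), β = fun k => l * σ (b k)) → (∀ (σ τ : K →+* ℂ) (l : ℂ), ((fun k => σ (b k)) = fun k => l * τ (b k)) → σ = τ) → Module.finrank ℚ K = ideg 𝔭 1 → ∀ (i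 : Fin (m + 1)), b i ≠ 0 → ∃ j : Fin (m + 1), Module.finrank ↥(IntermediateField.adjoin ℚ {b j / b i}) K ≤ ideg 𝔮 2 := by
  intro m hm 𝔭 𝔮 h𝔮 h𝔮hom h𝔮unm hle K _ _ b hzeros hinj hdeg i hi
  exact OrbitFloor.exists_chart_finrank_le hm h𝔮 h𝔮hom h𝔮unm hle b hzeros hinj hdeg hi

end Summit.Schanuel.Schanuel.Cruxes.ApproximationProperty.OrbitInterpolationDeterminant

end
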